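import Summits.Ventures.PercRepro2.CaseOnePairPocket

/-!
# Connections through a pocket, and in its tree gadget
(blind cell PercRepro2, p1 g27; the graph side of the second pocket reduction)

For a pocket `(W, x, P)` the connections of `G` factor through the outside and inside configurations
(`conn_outOnly_iff`, `conn_of_mem_iff` of `CaseOnePocketOut`). In the tree gadget
`pairEnds` (`e₁ = {x, w}`, `e₂ = {w, z₁}`, `e₃ = {w, z₂}`, the other edges of `P` loops at `x`) the same
two statements hold with «`z₁ ↔ x` through `P`» replaced by «`e₁` and `e₂` open»
(`conn_pairEnds_out_iff`, `conn_pairEnds_z_iff`). Every proof is the closure lemma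
`mem_of_conn_of_closed` of `Graph.lean` with an explicit closed vertex set. Own code; standard axioms. -/

namespace Summit.Ventures.PercRepro2

namespace CaseOne

/-! ## Connections in the tree gadget -/

section PairConnT
variable {V : Type*} {E : Type*} [DecidableEq E] {ends : E → Sym2 V} {W : Set V} {x : V}
  {P : Finset E} {e₁ e₂ e₃ : E} {w z₁ z₂ : V} (ω : Config E)

/-- The stem of the gadget. -/
lemma pairEnds_e₁ : pairEnds ends P e₁ e₂ e₃ x w z₁ z₂ e₁ = s(x, w) := by simp [pairEnds]

/-- The first branch of the gadget. -/
lemma pairEnds_e₂ (h12 : e₁ ≠ e₂) : pairEnds ends P e₁ e₂ e₃ x w z₁ z₂ e₂ = s(w, z₁) := by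
  simp [pairEnds, h12.symm]

/-- The second branch of the gadget. -/
lemma pairEnds_e₃ (h13 : e₁ ≠ e₃) (h23 : e₂ ≠ e₃) :
    pairEnds ends P e₁ e₂ e₃ x w z₁ z₂ e₃ = s(w, z₂) := by
  simp [pairEnds, h13.symm, h23.symm]

/-- The other edges of `P` are loops at `x`. -/
lemma pairEnds_of_mem {e : E} (he : e ∈ P) (h1 : e ≠ e₁) (h2 : e ≠ e₂) (h3 : e ≠ e₃) :
    pairEnds ends P e₁ e₂ e₃ x w z₁ z₂ e = s(x, x) := by
  simp [pairEnds, he, h1, h2, h3]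

/-- The edges off `P` keep their ends. -/
lemma pairEnds_of_not_mem {e : E} (he : e ∉ P) (he₁ : e₁ ∈ P) (he₂ : e₂ ∈ P) (he₃ : e₃ ∈ P) :
    pairEnds ends P e₁ e₂ e₃ x w z₁ z₂ e = ends e := by
  have h1 : e ≠ e₁ := fun h => he (h ▸ he₁)
  have h2 : e ≠ e₂ := fun h => he (h ▸ he₂)
  have h3 : e ≠ e₃ := fun h => he (h ▸ he₃)
  simp [pairEnds, he, h1, h2, h3]

/-- **The gadget graph and its configuration**: the data of a pocket with two designated vertices
`z₁, z₂` and a hub `w`, three distinct edges `e₁, e₂, e₃` of `P`. -/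
structure IsPairPocket (ends : E → Sym2 V) (W : Set V) (x : V) (P : Finset E) (e₁ e₂ e₃ : E)
    (w z₁ z₂ : V) : Prop where
  /-- the pocket -/
  pocket : IsPocket ends W x P
  /-- `e₁ ∈ P` -/
  mem₁ : e₁ ∈ P
  /-- `e₂ ∈ P` -/
  mem₂ : e₂ ∈ P
  /-- `e₃ ∈ P` -/
  mem₃ : e₃ ∈ P
  /-- `e₁ ≠ e₂` -/
  ne₁₂ : e₁ ≠ e₂
  /-- `e₁ ≠ e₃` -/
  ne₁₃ : e₁ ≠ e₃
  /-- `e₂ ≠ e₃` -/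
  ne₂₃ : e₂ ≠ e₃
  /-- the hub is in the pocket -/
  hub : w ∈ W
  /-- `z₁` is in the pocket -/
  mem_z₁ : z₁ ∈ W
  /-- `z₂` is in the pocket -/
  mem_z₂ : z₂ ∈ W
  /-- the hub is not `z₁` -/
  hub_ne₁ : w ≠ z₁
  /-- the hub is not `z₂` -/
  hub_ne₂ : w ≠ z₂
  /-- the two designated vertices are distinct -/
  ne_z : z₁ ≠ z₂

variable (hh : IsPairPocket ends W x P e₁ e₂ e₃ w z₁ z₂)

include hh

/-- An open edge of the gadget configuration, by cases: the stem, a branch, a loop at `x`, or an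
outside edge. -/
lemma pairEnds_cases {e : E} {y z : V}
    (hends : pairEnds ends P e₁ e₂ e₃ x w z₁ z₂ e = s(y, z)) :
    (e = e₁ ∧ s(x, w) = s(y, z)) ∨ (e = e₂ ∧ s(w, z₁) = s(y, z)) ∨ (e = e₃ ∧ s(w, z₂) = s(y, z)) ∨
      (y = x ∧ z = x) ∨ (e ∉ P ∧ ends e = s(y, z) ∧ y ∉ W ∧ z ∉ W) := by
  by_cases h1 : e = e₁
  · exact Or.inl ⟨h1, by rw [h1, pairEnds_e₁] at hends; exact hends⟩
  by_cases h2 : e = e₂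
  · exact Or.inr (Or.inl ⟨h2, by rw [h2, pairEnds_e₂ hh.ne₁₂] at hends; exact hends⟩)
  by_cases h3 : e = e₃
  · exact Or.inr (Or.inr (Or.inl ⟨h3, by rw [h3, pairEnds_e₃ hh.ne₁₃ hh.ne₂₃] at hends; exact hends⟩))
  by_cases heP : e ∈ P
  · rw [pairEnds_of_mem heP h1 h2 h3, Sym2.eq_iff] at hends
    refine Or.inr (Or.inr (Or.inr (Or.inl ?_)))
    rcases hends with ⟨rfl, rfl⟩ | ⟨rfl, rfl⟩ <;> exact ⟨rfl, rfl⟩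
  · rw [pairEnds_of_not_mem heP hh.mem₁ hh.mem₂ hh.mem₃] at hends
    refine Or.inr (Or.inr (Or.inr (Or.inr ⟨heP, hends, ?_, ?_⟩)))
    · exact hh.pocket.not_mem_W heP (by rw [hends]; exact Sym2.mem_mk_left y z)
    · exact hh.pocket.not_mem_W heP (by rw [hends]; exact Sym2.mem_mk_right y z)

/-- An outside connection of the outside configuration is a connection of the gadget. -/
lemma conn_pairEnds_of_conn_outOnly {u v : V} (huv : Conn ends (outOnly P ω) u v) :
    Conn (pairEnds ends P e₁ e₂ e₃ x w z₁ z₂) ω u v := by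
  let S : Set V := {y | Conn (pairEnds ends P e₁ e₂ e₃ x w z₁ z₂) ω u y}
  have hS : ∀ y ∈ S, ∀ z, (openGraph ends (outOnly P ω)).Adj y z → z ∈ S := by
    intro y hy z hadj
    rw [openGraph_adj] at hadj
    obtain ⟨-, e, hopen, hends⟩ := hadj
    have heP : e ∉ P := by
      intro heP
      simp [heP] at hopen
    have hopen' : ω e = true := by simpa [heP] using hopen
    refine conn_trans hy (conn_of_openAdj ⟨e, hopen', ?_⟩)
    rw [pairEnds_of_not_mem heP hh.mem₁ hh.mem₂ hh.mem₃]
    exact hends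
  exact mem_of_conn_of_closed hS (conn_refl _ _ u) huv

/-- **Connections between outside vertices in the gadget are outside connections.** -/
theorem conn_pairEnds_out_iff {u v : V} (hu : u ∉ W) (hv : v ∉ W) :
    Conn (pairEnds ends P e₁ e₂ e₃ x w z₁ z₂) ω u v ↔ Conn ends (outOnly P ω) u v := by
  constructor
  · intro huv
    let S : Set V := {y | (y ∉ W ∧ Conn ends (outOnly P ω) u y) ∨
      (y ∈ W ∧ Conn ends (outOnly P ω) u x)}
    have hS : ∀ y ∈ S, ∀ z, (openGraph (pairEnds ends P e₁ e₂ e₃ x w z₁ z₂) ω).Adj y z → z ∈ S := by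
      intro y hy z hadj
      rw [openGraph_adj] at hadj
      obtain ⟨-, e, hopen, hends⟩ := hadj
      rcases pairEnds_cases hh hends with
        ⟨-, hs⟩ | ⟨-, hs⟩ | ⟨-, hs⟩ | ⟨rfl, rfl⟩ | ⟨heP, hends', hyW, hzW⟩
      · -- the stem `{x, w}`
        rw [Sym2.eq_iff] at hs
        rcases hs with ⟨rfl, rfl⟩ | ⟨rfl, rfl⟩
        · rcases hy with ⟨-, hcy⟩ | ⟨hyW, -⟩
          · exact Or.inr ⟨hh.hub, hcy⟩
          · exact absurd hyW hh.pocket.x_not_mem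
        · rcases hy with ⟨hyW, -⟩ | ⟨-, hcx⟩
          · exact absurd hh.hub hyW
          · exact Or.inl ⟨hh.pocket.x_not_mem, hcx⟩
      · -- the branch `{w, z₁}` stays in `W`
        rw [Sym2.eq_iff] at hs
        rcases hs with ⟨rfl, rfl⟩ | ⟨rfl, rfl⟩
        · rcases hy with ⟨hyW, -⟩ | ⟨-, hcx⟩
          · exact absurd hh.hub hyW
          · exact Or.inr ⟨hh.mem_z₁, hcx⟩
        · rcases hy with ⟨hyW, -⟩ | ⟨-, hcx⟩
          · exact absurd hh.mem_z₁ hyW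
          · exact Or.inr ⟨hh.hub, hcx⟩
      · -- the branch `{w, z₂}` stays in `W`
        rw [Sym2.eq_iff] at hs
        rcases hs with ⟨rfl, rfl⟩ | ⟨rfl, rfl⟩
        · rcases hy with ⟨hyW, -⟩ | ⟨-, hcx⟩
          · exact absurd hh.hub hyW
          · exact Or.inr ⟨hh.mem_z₂, hcx⟩
        · rcases hy with ⟨hyW, -⟩ | ⟨-, hcx⟩
          · exact absurd hh.mem_z₂ hyW
          · exact Or.inr ⟨hh.hub, hcx⟩
      · -- a loop at `x`
        exact hy
      · -- an outside edge
        have hopen' : outOnly P ω e = true := by simp [heP, hopen]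
        rcases hy with ⟨-, hcy⟩ | ⟨hyW', -⟩
        · exact Or.inl ⟨hzW, conn_trans hcy (conn_of_openAdj ⟨e, hopen', hends'⟩)⟩
        · exact absurd hyW' hyW
    have hvS : v ∈ S := mem_of_conn_of_closed hS (Or.inl ⟨hu, conn_refl _ _ u⟩) huv
    rcases hvS with ⟨-, hcv⟩ | ⟨hvW, -⟩
    · exact hcv
    · exact absurd hvW hv
  · exact conn_pairEnds_of_conn_outOnly ω hh

/-- **A connection from `z₁` to the outside in the gadget**: the stem and the first branch are open,
and `x ↔ v` outside. -/
theorem conn_pairEnds_z₁_iff {v : V} (hv : v ∉ W) :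
    Conn (pairEnds ends P e₁ e₂ e₃ x w z₁ z₂) ω z₁ v ↔
      (ω e₁ = true ∧ ω e₂ = true ∧ Conn ends (outOnly P ω) x v) := by
  constructor
  · intro hzv
    let S : Set V := {y | y = z₁ ∨ (y = w ∧ ω e₂ = true) ∨ (y = z₂ ∧ ω e₂ = true ∧ ω e₃ = true) ∨
      (y ∉ W ∧ ω e₂ = true ∧ ω e₁ = true ∧ Conn ends (outOnly P ω) x y)}
    have hS : ∀ y ∈ S, ∀ z, (openGraph (pairEnds ends P e₁ e₂ e₃ x w z₁ z₂) ω).Adj y z → z ∈ S := by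
      intro y hy z hadj
      rw [openGraph_adj] at hadj
      obtain ⟨-, e, hopen, hends⟩ := hadj
      rcases pairEnds_cases hh hends with
        ⟨rfl, hs⟩ | ⟨rfl, hs⟩ | ⟨rfl, hs⟩ | ⟨rfl, rfl⟩ | ⟨heP, hends', hyW, hzW⟩
      · -- the stem `{x, w}`
        rw [Sym2.eq_iff] at hs
        rcases hs with ⟨rfl, rfl⟩ | ⟨rfl, rfl⟩
        · -- from `x` to `w`
          rcases hy with rfl | ⟨rfl, -⟩ | ⟨rfl, -, -⟩ | ⟨-, h2, -, -⟩
          · exact absurd hh.mem_z₁ hh.pocket.x_not_mem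
          · exact absurd hh.hub hh.pocket.x_not_mem
          · exact absurd hh.mem_z₂ hh.pocket.x_not_mem
          · exact Or.inr (Or.inl ⟨rfl, h2⟩)
        · -- from `w` to `x`
          rcases hy with rfl | ⟨-, h2⟩ | ⟨hwz, -, -⟩ | ⟨hwW, -, -, -⟩
          · exact absurd rfl hh.hub_ne₁
          · exact Or.inr (Or.inr (Or.inr ⟨hh.pocket.x_not_mem, h2, hopen, conn_refl _ _ _⟩))
          · exact absurd hwz hh.hub_ne₂
          · exact absurd hh.hub hwW
      · -- the branch `{w, z₁}`
        rw [Sym2.eq_iff] at hs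
        rcases hs with ⟨rfl, rfl⟩ | ⟨rfl, rfl⟩
        · exact Or.inl rfl
        · exact Or.inr (Or.inl ⟨rfl, hopen⟩)
      · -- the branch `{w, z₂}`
        rw [Sym2.eq_iff] at hs
        rcases hs with ⟨rfl, rfl⟩ | ⟨rfl, rfl⟩
        · -- from `w` to `z₂`
          rcases hy with rfl | ⟨-, h2⟩ | ⟨hwz, -, -⟩ | ⟨hwW, -, -, -⟩
          · exact absurd rfl hh.hub_ne₁
          · exact Or.inr (Or.inr (Or.inl ⟨rfl, h2, hopen⟩))
          · exact absurd hwz hh.hub_ne₂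
          · exact absurd hh.hub hwW
        · -- from `z₂` to `w`
          rcases hy with hz | ⟨hz, -⟩ | ⟨-, h2, -⟩ | ⟨hzW, -, -, -⟩
          · exact absurd hz.symm hh.ne_z
          · exact absurd hz.symm hh.hub_ne₂
          · exact Or.inr (Or.inl ⟨rfl, h2⟩)
          · exact absurd hh.mem_z₂ hzW
      · -- a loop at `x`
        exact hy
      · -- an outside edge
        have hopen' : outOnly P ω e = true := by simp [heP, hopen]
        rcases hy with rfl | ⟨rfl, -⟩ | ⟨rfl, -, -⟩ | ⟨-, h2, h1, hcy⟩
        · exact absurd hh.mem_z₁ hyW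
        · exact absurd hh.hub hyW
        · exact absurd hh.mem_z₂ hyW
        · exact Or.inr (Or.inr (Or.inr ⟨hzW, h2, h1,
            conn_trans hcy (conn_of_openAdj ⟨e, hopen', hends'⟩)⟩))
    have hvS : v ∈ S := mem_of_conn_of_closed hS (Or.inl rfl) hzv
    rcases hvS with rfl | ⟨rfl, -⟩ | ⟨rfl, -, -⟩ | ⟨-, h2, h1, hcv⟩
    · exact absurd hh.mem_z₁ hv
    · exact absurd hh.hub hv
    · exact absurd hh.mem_z₂ hv
    · exact ⟨h1, h2, hcv⟩
  · rintro ⟨h1, h2, hcv⟩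
    have hzw : Conn (pairEnds ends P e₁ e₂ e₃ x w z₁ z₂) ω z₁ w :=
      conn_of_openAdj ⟨e₂, h2, by rw [pairEnds_e₂ hh.ne₁₂, Sym2.eq_swap]⟩
    have hwx : Conn (pairEnds ends P e₁ e₂ e₃ x w z₁ z₂) ω w x :=
      conn_of_openAdj ⟨e₁, h1, by rw [pairEnds_e₁, Sym2.eq_swap]⟩
    exact conn_trans hzw (conn_trans hwx (conn_pairEnds_of_conn_outOnly ω hh hcv))

/-- **A connection from `z₂` to the outside in the gadget**: the stem and the second branch are open,
and `x ↔ v` outside. -/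
theorem conn_pairEnds_z₂_iff {v : V} (hv : v ∉ W) :
    Conn (pairEnds ends P e₁ e₂ e₃ x w z₁ z₂) ω z₂ v ↔
      (ω e₁ = true ∧ ω e₃ = true ∧ Conn ends (outOnly P ω) x v) := by
  constructor
  · intro hzv
    let S : Set V := {y | y = z₂ ∨ (y = w ∧ ω e₃ = true) ∨ (y = z₁ ∧ ω e₃ = true ∧ ω e₂ = true) ∨
      (y ∉ W ∧ ω e₃ = true ∧ ω e₁ = true ∧ Conn ends (outOnly P ω) x y)}
    have hS : ∀ y ∈ S, ∀ z, (openGraph (pairEnds ends P e₁ e₂ e₃ x w z₁ z₂) ω).Adj y z → z ∈ S := by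
      intro y hy z hadj
      rw [openGraph_adj] at hadj
      obtain ⟨-, e, hopen, hends⟩ := hadj
      rcases pairEnds_cases hh hends with
        ⟨rfl, hs⟩ | ⟨rfl, hs⟩ | ⟨rfl, hs⟩ | ⟨rfl, rfl⟩ | ⟨heP, hends', hyW, hzW⟩
      · -- the stem `{x, w}`
        rw [Sym2.eq_iff] at hs
        rcases hs with ⟨rfl, rfl⟩ | ⟨rfl, rfl⟩
        · rcases hy with rfl | ⟨rfl, -⟩ | ⟨rfl, -, -⟩ | ⟨-, h3, -, -⟩
          · exact absurd hh.mem_z₂ hh.pocket.x_not_mem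
          · exact absurd hh.hub hh.pocket.x_not_mem
          · exact absurd hh.mem_z₁ hh.pocket.x_not_mem
          · exact Or.inr (Or.inl ⟨rfl, h3⟩)
        · rcases hy with rfl | ⟨-, h3⟩ | ⟨hwz, -, -⟩ | ⟨hwW, -, -, -⟩
          · exact absurd rfl hh.hub_ne₂
          · exact Or.inr (Or.inr (Or.inr ⟨hh.pocket.x_not_mem, h3, hopen, conn_refl _ _ _⟩))
          · exact absurd hwz hh.hub_ne₁
          · exact absurd hh.hub hwW
      · -- the branch `{w, z₁}`
        rw [Sym2.eq_iff] at hs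
        rcases hs with ⟨rfl, rfl⟩ | ⟨rfl, rfl⟩
        · -- from `w` to `z₁`
          rcases hy with rfl | ⟨-, h3⟩ | ⟨hwz, -, -⟩ | ⟨hwW, -, -, -⟩
          · exact absurd rfl hh.hub_ne₂
          · exact Or.inr (Or.inr (Or.inl ⟨rfl, h3, hopen⟩))
          · exact absurd hwz hh.hub_ne₁
          · exact absurd hh.hub hwW
        · -- from `z₁` to `w`
          rcases hy with hz | ⟨hz, -⟩ | ⟨-, h3, -⟩ | ⟨hzW, -, -, -⟩
          · exact absurd hz hh.ne_z
          · exact absurd hz.symm hh.hub_ne₁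
          · exact Or.inr (Or.inl ⟨rfl, h3⟩)
          · exact absurd hh.mem_z₁ hzW
      · -- the branch `{w, z₂}`
        rw [Sym2.eq_iff] at hs
        rcases hs with ⟨rfl, rfl⟩ | ⟨rfl, rfl⟩
        · exact Or.inl rfl
        · exact Or.inr (Or.inl ⟨rfl, hopen⟩)
      · -- a loop at `x`
        exact hy
      · -- an outside edge
        have hopen' : outOnly P ω e = true := by simp [heP, hopen]
        rcases hy with rfl | ⟨rfl, -⟩ | ⟨rfl, -, -⟩ | ⟨-, h3, h1, hcy⟩
        · exact absurd hh.mem_z₂ hyW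
        · exact absurd hh.hub hyW
        · exact absurd hh.mem_z₁ hyW
        · exact Or.inr (Or.inr (Or.inr ⟨hzW, h3, h1,
            conn_trans hcy (conn_of_openAdj ⟨e, hopen', hends'⟩)⟩))
    have hvS : v ∈ S := mem_of_conn_of_closed hS (Or.inl rfl) hzv
    rcases hvS with rfl | ⟨rfl, -⟩ | ⟨rfl, -, -⟩ | ⟨-, h3, h1, hcv⟩
    · exact absurd hh.mem_z₂ hv
    · exact absurd hh.hub hv
    · exact absurd hh.mem_z₁ hv
    · exact ⟨h1, h3, hcv⟩
  · rintro ⟨h1, h3, hcv⟩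
    have hzw : Conn (pairEnds ends P e₁ e₂ e₃ x w z₁ z₂) ω z₂ w :=
      conn_of_openAdj ⟨e₃, h3, by rw [pairEnds_e₃ hh.ne₁₃ hh.ne₂₃, Sym2.eq_swap]⟩
    have hwx : Conn (pairEnds ends P e₁ e₂ e₃ x w z₁ z₂) ω w x :=
      conn_of_openAdj ⟨e₁, h1, by rw [pairEnds_e₁, Sym2.eq_swap]⟩
    exact conn_trans hzw (conn_trans hwx (conn_pairEnds_of_conn_outOnly ω hh hcv))

end PairConnT

end CaseOne

end Summit.Ventures.PercRepro2
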